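import Summits.KontsevichZagierPeriods.Zeta5Search.Certificates.RayH1KernelStepTail
import HarnessLib

/-!
# ζ(5) search — certificates: the table theorem of the ray RayH1 WITH THE UNIFORM BRICK TAIL (TYPER g17; generator `gen_kernelclass.py H1`)

HONEST FRAMING: systematic search; no irrationality claim unless certified.  Valuation bookkeeping of explicit rationals; every
exponent this yields in the cell is `< 1` — a calibration, nothing about the arithmetic nature of `ζ(5)`.

OUR work (Summit side; typer seat g17's generator, run VERBATIM for the ray H1 by prover seat p3 g7).  Sequel of `RayH1KernelClassTable` (`kMT`, `h1_exponent_of_table`) and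
`RayH1KernelStepTail` (`tailFactor`, `tailFactor_dvd`, `eventually_exp_le_tailFactor`):
* `kMTT tab n = kMT tab n / tailFactor n`; `headOK` (decidable: the first window starts at `θ ≥ 1/4`); `corrT_dvd` (the combined window product divides both numerators), `le_of_dvd_tailFactor`
  (a prime of the tail factor has `p·4 ≤ n`; stated as `q * 4 ≤ n` to differ from the C5 twin), `coprime_corrT_tailFactor` (the window product and the tail factor are coprime as soon as
  every table window lies above `θ = 1/4` — checked on the head of the chained table), `kMTT_ints` (`n ≥ max(NT, 850)`),
  `eventually_kMTT_le_exp` (rate `141.7159 − R − 1.0684`);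
* **`h1_exponent_of_table_tail`** — for a sound checker, a checked and chained table above `θ = 1/4` with rate `R`, every `γ ≥ 0` with
  `γ·((141.7159 − R − 1.0684 + 0.01) + 364673 / 5000) < 729343 / 10000 + 273999/10000` is an effective exponent of the ray.
-/

noncomputable section

open Finset Real Filter Topology

namespace Summit.KontsevichZagierPeriods.Zeta5Search.RayH1

open Summit.KontsevichZagierPeriods.Zeta5Search.DualSeries
open Summit.KontsevichZagierPeriods.Zeta5Search.DualSeriesDenominators
open Summit.KontsevichZagierPeriods.Zeta5Search.WedgeDictionary
open Summit.KontsevichZagierPeriods.Zeta5Search.RayKernel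
open Summit.KontsevichZagierPeriods.Zeta5Search.Denom.DigitCert
open Literature.NumberTheory.Irrationality.Hata1992
open Literature.NumberTheory.Transcendental (zetaValue)

/-! ### The table theorem with the tail factor -/

variable (tab : List WinEntry)

/-- **The multiplier with the uniform tail**: `kMTT tab n = kMT tab n / tailFactor n`. -/
def kMTT (n : ℕ) : ℚ := kMT tab n / (tailFactor n : ℚ)

/-- Decidable head check of a table: its first window starts at or above `θ = 1/4` (so, for a chained table, all windows do). -/
def headOK : List WinEntry → Bool
  | [] => true
  | e :: _ => decide ((1 : ℚ) / 4 ≤ e.1)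

variable {tab}

/-- The head check gives the bound on the first entry. -/
theorem headOK_first (hh : headOK tab = true) (h : 0 < tab.length) : (1 : ℚ) / 4 ≤ (tab[0]).1 := by
  cases tab with
  | nil => simp at h
  | cons e t => simpa [headOK] using hh

/-- The combined window product of `RayH1KernelClassTable` divides both numerators (`n ≥ NT`). -/
theorem corrT_dvd {ok : WinEntry → Bool} {NT : ℕ} (hs : SoundChecker ok NT) (hNT : 1 ≤ NT)
    (hok : tab.all ok = true) (hchain : chainOK tab = true) {n : ℕ} (hn : NT ≤ n) :
    ((corrT tab n : ℕ) : ℤ) ∣ wedgeNumZ (bH1 n) (bH1' n) ∧ ((corrT tab n : ℕ) : ℤ) ∣ qNumZ (bH1 n) (bH1' n) := by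
  classical
  have hn1 : 1 ≤ n := le_trans hNT hn
  have hcert : ∀ i ∈ (Finset.univ : Finset (Fin 4 ⊕ Fin tab.length)), ∀ p ∈ windowPrimes (cAT tab i) (cBT tab i) n,
      (p : ℤ) ^ cwT tab i ∣ wedgeNumZ (bH1 n) (bH1' n) ∧ (p : ℤ) ^ cwT tab i ∣ qNumZ (bH1 n) (bH1' n) := by
    rintro (i | i) - p hp
    · simp only [cAT, cBT, cwT, Sum.elim_inl] at hp ⊢
      obtain ⟨hpr, hlo, hhi, hk⟩ := windowK_prime hp
      exact cert_bH1 hn1 hpr hlo hhi hk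
    · simp only [cAT, cBT, cwT, Sum.elim_inr] at hp ⊢
      exact (hs _ (getElem_all hok i i.isLt)).2 n hn p hp
  unfold corrT
  exact ⟨multiWindowProd_dvd_int (fun i hi p hp => (hcert i hi p hp).1) (combined_disjointT hs hok hchain n),
    multiWindowProd_dvd_int (fun i hi p hp => (hcert i hi p hp).2) (combined_disjointT hs hok hchain n)⟩

/-- A prime of the tail factor has `⌊n/p⌋ ≥ 4`, i.e. `4·p ≤ n`. -/
theorem le_of_dvd_tailFactor {n q : ℕ} (hq : q.Prime) (hdvd : q ∣ tailFactor n) : q * 4 ≤ n := by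
  rw [Nat.mul_comm]
  haveI := Fact.mk hq
  have hv : 0 < padicValNat q (tailFactor n) :=
    one_le_padicValNat_of_dvd (stepFactorTrunc_pos _ _ _ _ _ _ _).ne' hdvd
  unfold tailFactor at hv
  rw [padicValNat_stepFactorTrunc tUV hq] at hv
  split_ifs at hv with h
  · have h16 : (4 : ℕ) ≤ ⌊(n : ℝ) / q⌋₊ := h.1
    clear hv h
    have hq0 : (0 : ℝ) < q := by exact_mod_cast hq.pos
    have : (4 : ℝ) ≤ (n : ℝ) / q := le_trans (by exact_mod_cast h16) (Nat.floor_le (by positivity))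
    rw [le_div_iff₀ hq0] at this
    exact_mod_cast this
  · exact absurd hv (lt_irrefl 0)

/-- The window product and the tail factor are coprime when every table window lies above `θ = 1/4`. -/
theorem coprime_corrT_tailFactor {ok : WinEntry → Bool} {NT : ℕ} (hs : SoundChecker ok NT) (hok : tab.all ok = true)
    (hchain : chainOK tab = true) (hhead : headOK tab = true) (n : ℕ) :
    Nat.Coprime (corrT tab n) (tailFactor n) := by
  classical
  apply Nat.coprime_of_dvd
  intro q hq hq1 hq2
  have h16 : 4 * q ≤ n := by have := le_of_dvd_tailFactor hq hq2; omega
  -- q divides some window product: q is a prime of one of the windows, all of which have θ > 1/4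
  unfold corrT multiWindowProd at hq1
  haveI := Fact.mk hq
  obtain ⟨i, -, hi⟩ := ((Nat.prime_iff.1 hq).dvd_finsetProd_iff _).1 hq1
  have hi' : q ∣ windowProd (cAT tab i) (cBT tab i) n := hq.dvd_of_dvd_pow hi
  have hmem : q ∈ windowPrimes (cAT tab i) (cBT tab i) n := by
    have hv := one_le_padicValNat_of_dvd (windowProd_pos _ _ _).ne' hi'
    rw [padicValNat_windowProd hq] at hv
    split_ifs at hv with h
    · exact h
    · exact absurd hv (by norm_num)
  rcases i with i | i
  · simp only [cAT, cBT, Sum.elim_inl] at hmem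
    obtain ⟨-, hlo, -, -⟩ := windowK_prime hmem
    -- big-prime windows: 15 n < q
    omega
  · simp only [cAT, cBT, Sum.elim_inr] at hmem
    have hA0 : (0 : ℝ) ≤ ((tA tab i : ℚ) : ℝ) := by exact_mod_cast (tab_basic hs hok i).1.le
    obtain ⟨-, hlo, -⟩ := (mem_windowPrimes_iff hA0).1 hmem
    have hhd : (1 : ℚ) / 4 ≤ tA tab i := by
      have h0 := headOK_first hhead (by have := i.isLt; omega)
      exact le_trans h0 (chainOK_head_le hchain i i.isLt)
    have : ((1 : ℚ) / 4 : ℝ) * n ≤ ((tA tab i : ℚ) : ℝ) * n := by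
      apply mul_le_mul_of_nonneg_right _ (Nat.cast_nonneg n); exact_mod_cast hhd
    have h16' : (4 : ℝ) * q ≤ n := by exact_mod_cast h16
    push_cast at this
    linarith

/-- **`0 < kMTT n`, `kMTT n · P_n ∈ ℤ`, `kMTT n · Q(a·n) ∈ ℤ`** for `n ≥ max(NT, 850)`. -/
theorem kMTT_ints {ok : WinEntry → Bool} {NT : ℕ} (hs : SoundChecker ok NT) (hNT : 1 ≤ NT)
    (hok : tab.all ok = true) (hchain : chainOK tab = true) (hhead : headOK tab = true)
    {n : ℕ} (hn : NT ≤ n) (hn2 : 850 ≤ n) :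
    0 < kMTT tab n ∧ (∃ z : ℤ, kMTT tab n * h1P n = z) ∧ (∃ z : ℤ, kMTT tab n * (h1Q n : ℚ) = z) := by
  have hn1 : 1 ≤ n := le_trans hNT hn
  obtain ⟨hw1, hq1⟩ := corrT_dvd hs hNT hok hchain hn
  obtain ⟨hw2, hq2⟩ := tailFactor_dvd hn2
  have hcop := coprime_corrT_tailFactor hs hok hchain hhead n
  have hdw : ((corrT tab n * tailFactor n : ℕ) : ℤ) ∣ wedgeNumZ (bH1 n) (bH1' n) := by
    push_cast; exact (Nat.isCoprime_iff_coprime.2 hcop).mul_dvd hw1 hw2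
  have hdq : ((corrT tab n * tailFactor n : ℕ) : ℤ) ∣ qNumZ (bH1 n) (bH1' n) := by
    push_cast; exact (Nat.isCoprime_iff_coprime.2 hcop).mul_dvd hq1 hq2
  have hΦ : 0 < corrT tab n * tailFactor n := Nat.mul_pos (multiWindowProd_pos _ _ _ _ _) (stepFactorTrunc_pos _ _ _ _ _ _ _)
  have h := div_ints (sharpAdmissible_bH1 hn1) (sharpAdmissible_bH1' hn1) (bn0_bH1' n) (rhoOf_aH1_ne_zero n) hΦ hdw hdq
  have hcast : baseMult (bH1 n) (bH1' n) (rhoOf (aH1 n)) / ((corrT tab n * tailFactor n : ℕ) : ℚ) = kMTT tab n := by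
    unfold kMTT kMT kM0; push_cast; rw [div_div]
  rw [hcast] at h
  obtain ⟨h0, hP, hQ⟩ := h
  refine ⟨h0, ?_, ?_⟩
  · unfold h1P; exact hP
  · rw [h1Q_eq_wedge hn1]; exact hQ

/-- **Size**: eventually `kMTT n ≤ e^{((141.7159 − R) − 1.0684 + ε)·n}` (`R` the table's rate). -/
theorem eventually_kMTT_le_exp {ok : WinEntry → Bool} {NT : ℕ} (hs : SoundChecker ok NT) (hok : tab.all ok = true) {R : ℚ}
    (hrate : (tab.map fun e => (e.2.2.1 : ℚ) * (e.2.1 - e.1)).sum = R) {ε : ℝ} (hε : 0 < ε) :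
    ∀ᶠ n : ℕ in atTop, ((kMTT tab n : ℚ) : ℝ) ≤ Real.exp ((((1417159 / 10000 - R : ℚ) : ℝ) - 2671 / 2500 + ε) * n) := by
  have hε2 : 0 < ε / 2 := by positivity
  filter_upwards [eventually_kMT_le_exp hs hok hrate hε2, eventually_exp_le_tailFactor hε2] with n h1 h2
  have htpos : (0 : ℝ) < ((tailFactor n : ℕ) : ℝ) := by exact_mod_cast stepFactorTrunc_pos _ _ _ _ _ _ _
  have hcast : ((kMTT tab n : ℚ) : ℝ) = ((kMT tab n : ℚ) : ℝ) / ((tailFactor n : ℕ) : ℝ) := by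
    unfold kMTT; push_cast; rfl
  rw [hcast, div_le_iff₀ htpos]
  calc ((kMT tab n : ℚ) : ℝ) ≤ Real.exp (((((1417159 / 10000 - R : ℚ)) : ℝ) + ε / 2) * n) := h1
    _ = Real.exp ((((1417159 / 10000 - R : ℚ) : ℝ) - 2671 / 2500 + ε) * n) * Real.exp ((2671 / 2500 - ε / 2) * n) := by
        rw [← Real.exp_add]; ring_nf
    _ ≤ Real.exp ((((1417159 / 10000 - R : ℚ) : ℝ) - 2671 / 2500 + ε) * n) * ((tailFactor n : ℕ) : ℝ) :=
        mul_le_mul_of_nonneg_left h2 (Real.exp_pos _).le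

/-- **THE TABLE THEOREM WITH THE UNIFORM TAIL.**  For a sound checker, a checked and chained table whose windows lie above `θ = 1/4`
with rate `R`, every `γ ≥ 0` with `γ·((141.7159 − R − 1.0684 + 0.01) + 364673 / 5000) < 729343 / 10000 − (-273999/10000)` is an effective
exponent of the ray: eventually `|ζ(5) − P_n/Q(a·n)| < 1/q_n^γ` with the integers `p_n = kMTT n·P_n`, `q_n = kMTT n·|Q(a·n)| ≥ 1`.
No irrationality content (`γ < 1` in every use). -/
theorem h1_exponent_of_table_tail {ok : WinEntry → Bool} {NT : ℕ} (hs : SoundChecker ok NT) (hNT : 1 ≤ NT)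
    (hok : tab.all ok = true) (hchain : chainOK tab = true) (hhead : headOK tab = true)
    {R : ℚ} (hrate : (tab.map fun e => (e.2.2.1 : ℚ) * (e.2.1 - e.1)).sum = R) {γ : ℝ} (hγ0 : 0 ≤ γ)
    (hγ : γ * (((((1417159 / 10000 - R - 2671 / 2500 + 1 / 100 : ℚ)) : ℝ)) + 364673 / 5000) < 729343 / 10000 - (-273999 / 10000)) :
    ∀ᶠ n : ℕ in atTop, ∃ p : ℤ, ∃ q : ℕ, 1 ≤ q ∧ (q : ℚ) = kMTT tab n * |(h1Q n : ℚ)| ∧ (p : ℚ) = kMTT tab n * h1P n ∧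
      |zetaValue 5 - (h1P n : ℝ) / (h1Q n : ℝ)| < 1 / (q : ℝ) ^ γ := by
  have hq : ((((1417159 / 10000 - R - 2671 / 2500 + 1 / 100 : ℚ)) : ℝ)) = (((1417159 / 10000 - R : ℚ)) : ℝ) - 2671 / 2500 + 1 / 100 := by
    push_cast; ring
  rw [hq] at hγ
  refine h1_exponent_rat (lam := (((1417159 / 10000 - R : ℚ)) : ℝ) - 2671 / 2500 + 1 / 100) (kMTT tab) (fun ε hε => ?_) hγ0 hγ
  filter_upwards [eventually_kMTT_le_exp hs hok hrate hε, eventually_ge_atTop (max NT 850)] with n hn hnN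
  obtain ⟨h0, hP, hQ⟩ := kMTT_ints hs hNT hok hchain hhead (le_trans (le_max_left _ _) hnN) (le_trans (le_max_right _ _) hnN)
  refine ⟨h0, hP, hQ, hn.trans ?_⟩
  apply Real.exp_le_exp.2; nlinarith [hε, (Nat.cast_nonneg n : (0:ℝ) ≤ n)]

end Summit.KontsevichZagierPeriods.Zeta5Search.RayH1
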